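import Literature.MathematicalPhysics.QuantumManyBody.BoseGasHardCoreContact
import Literature.MathematicalPhysics.QuantumManyBody.DiluteBoseGasUpperBoundLocalization
import HarnessLib

/-!
# Cutting a Dirichlet wave function off at a wall: the `C¹` profile, Poincaré at the wall, and the
# pointwise bookkeeping of the product cut-off

Topic `Literature/MathematicalPhysics/QuantumManyBody`, over the carriers of
`BoseEinsteinCondensation.lean` (`Config N = (ℝ³)^N`, `kineticDensity`, `TrialState`) and the
coordinate-line calculus of `BoseGasHardCoreContact.lean` (`linePoint`, `poincare_Ioo_of_zero`,
`lintegral_le_of_forall_line`). Elementary ingredients of the variational half of **Hadamard's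
formula** for the Dirichlet ground-state energy of a box (moving a wall of `Λ_L` inward by `w` costs
at most the energy carried within `2w` of that wall), used by the crux `RigidMomentumBound` of
`AtomisticToContinuum/BoseEinsteinCondensation` (Theorems file
`BECTangentRigidityRigidMomentumBoundStubShrinkBound.lean`):

* `WallCutoff.exists_wallProfile` — an explicit `C¹` wall profile
  `t ↦ (1 + cos(π · max 0 (min 1 ((t - a)/w))))/2`: `1` on `(-∞, a]`, `0` on `[a + w, ∞)`, values in
  `[0, 1]`, slope `-(π/w) sin(π · max 0 (min 1 ((t - a)/w)))/2` (continuous, `|·| ≤ π/(2w)`, zero off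
  the ramp). The one-sided derivatives vanish at both ends of the ramp, so the pieces glue
  (`HasDerivWithinAt.union`) and `contDiff_one_iff_deriv` concludes. No definition is introduced
  (the profile is written out); unlike `exists_smooth_cutoff` (built on `Real.smoothTransition`)
  the slope bound is an explicit number, which the Hadamard bound needs.
* `lintegral_wall_le` — **Poincaré at the wall**: for a `C¹` function vanishing as soon as
  `x_{i,k} ≥ L`, `∫_{x_{i,k} > L-s} |ψ|² ≤ s² ∫_{x_{i,k} > L-s} |∂_{i,k}ψ|²` (the one-dimensional
  Poincaré inequality with the zero at `t = L` on every line parallel to `e_{i,k}`, then Fubini).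
* `WallCutoff.kineticDensity_cut_le`, `WallCutoff.ennnormSq_cut_le`,
  `WallCutoff.ennnormSq_le_cut_add` — pointwise bookkeeping for the product cut-off
  `ψ · ∏_{i,k} θ(x_{i,k})` with `0 ≤ θ ≤ 1`, `|θ'| ≤ D`, `θ' = 0` on `(-∞, c]`, `θ = 1` on `(-∞, c]`:
  `|∇(ψχ)|² ≤ |∇ψ|² + ∑_{i,k} 1_{x_{i,k}>c} |∂_{i,k}ψ|² + 2D² ∑_{i,k} 1_{x_{i,k}>c} |ψ|²`
  (from `ennnorm_fderiv_cutoffState_sq_le` of `DiluteBoseGasUpperBoundLocalization.lean`),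
  `|ψχ|² ≤ |ψ|²`, and `|ψ|² ≤ |ψχ|² + ∑_{i,k} 1_{x_{i,k}>c} |ψ|²`.

Everything is a standard Sobolev-space / calculus fact and is tagged folklore. Deliberately NOT here:
the Hadamard bound itself (problem side), optimal constants, smooth (`C^∞`) profiles.

## References

* [LSSY2005] E. H. Lieb, R. Seiringer, J. P. Solovej, J. Yngvason, *The Mathematics of the Bose Gas
  and its Condensation* (2005), Ch. 2 (Dirichlet boxes; the variational set-up these lemmas serve).
-/

noncomputable section

namespace Literature.MathematicalPhysics.QuantumManyBody.BoseGas

open _root_.MeasureTheory _root_.Filter _root_.Set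
open scoped ENNReal NNReal Topology

namespace WallCutoff

/-! ### A `C¹` wall profile with an explicit slope bound -/

section Profile

open _root_.Real

variable {a w t : ℝ}

/-- Left of the ramp the clamped coordinate `max 0 (min 1 ((t - a)/w))` is `0`. [folklore] -/
theorem ramp_of_le (hw : 0 < w) (ht : t ≤ a) : max 0 (min 1 ((t - a) / w)) = 0 := by
  have h : (t - a) / w ≤ 0 := div_nonpos_of_nonpos_of_nonneg (by linarith) hw.le
  rw [min_eq_right (h.trans zero_le_one), max_eq_left h]

/-- Right of the ramp the clamped coordinate is `1`. [folklore] -/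
theorem ramp_of_ge (hw : 0 < w) (ht : a + w ≤ t) : max 0 (min 1 ((t - a) / w)) = 1 := by
  have h : 1 ≤ (t - a) / w := by rw [le_div_iff₀ hw]; linarith
  rw [min_eq_left h, max_eq_right zero_le_one]

/-- On the ramp the clamped coordinate is affine. [folklore] -/
theorem ramp_of_mem (hw : 0 < w) (ht : t ∈ Icc a (a + w)) :
    max 0 (min 1 ((t - a) / w)) = (t - a) / w := by
  have h0 : 0 ≤ (t - a) / w := div_nonneg (by linarith [ht.1]) hw.le
  have h1 : (t - a) / w ≤ 1 := by rw [div_le_iff₀ hw]; linarith [ht.2]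
  rw [min_eq_right h1, max_eq_right h0]

/-- The wall profile is `1` left of the ramp. [folklore] -/
theorem wallProfile_of_le (hw : 0 < w) (ht : t ≤ a) :
    (1 + cos (π * max 0 (min 1 ((t - a) / w)))) / 2 = 1 := by
  rw [ramp_of_le hw ht, mul_zero, cos_zero]; norm_num

/-- The wall profile is `0` right of the ramp. [folklore] -/
theorem wallProfile_of_ge (hw : 0 < w) (ht : a + w ≤ t) :
    (1 + cos (π * max 0 (min 1 ((t - a) / w)))) / 2 = 0 := by
  rw [ramp_of_ge hw ht, mul_one, cos_pi]; norm_num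

/-- The wall profile takes values in `[0, 1]`. [folklore] -/
theorem wallProfile_mem (a w t : ℝ) :
    0 ≤ (1 + cos (π * max 0 (min 1 ((t - a) / w)))) / 2 ∧
      (1 + cos (π * max 0 (min 1 ((t - a) / w)))) / 2 ≤ 1 := by
  have h1 := neg_one_le_cos (π * max 0 (min 1 ((t - a) / w)))
  have h2 := cos_le_one (π * max 0 (min 1 ((t - a) / w)))
  constructor <;> linarith

/-- The slope of the wall profile vanishes left of the ramp. [folklore] -/
theorem wallProfileDeriv_of_le (hw : 0 < w) (ht : t ≤ a) :
    -(π / w) * sin (π * max 0 (min 1 ((t - a) / w))) / 2 = 0 := by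
  rw [ramp_of_le hw ht, mul_zero, sin_zero]; ring

/-- The slope of the wall profile vanishes right of the ramp. [folklore] -/
theorem wallProfileDeriv_of_ge (hw : 0 < w) (ht : a + w ≤ t) :
    -(π / w) * sin (π * max 0 (min 1 ((t - a) / w))) / 2 = 0 := by
  rw [ramp_of_ge hw ht, mul_one, sin_pi]; ring

/-- The slope bound `|θ'| ≤ π/(2w)`. [folklore] -/
theorem abs_wallProfileDeriv_le (hw : 0 < w) (a t : ℝ) :
    |-(π / w) * sin (π * max 0 (min 1 ((t - a) / w))) / 2| ≤ π / (2 * w) := by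
  have hs := abs_sin_le_one (π * max 0 (min 1 ((t - a) / w)))
  have hpw : 0 < π / w := div_pos pi_pos hw
  rw [abs_div, abs_mul, abs_neg, abs_of_pos hpw, abs_two]
  calc π / w * |sin (π * max 0 (min 1 ((t - a) / w)))| / 2 ≤ π / w * 1 / 2 := by gcongr
    _ = π / (2 * w) := by ring

/-- The slope of the wall profile is continuous. [folklore] -/
theorem continuous_wallProfileDeriv (a w : ℝ) :
    Continuous fun t => -(π / w) * sin (π * max 0 (min 1 ((t - a) / w))) / 2 := by
  have h : Continuous fun t => max 0 (min 1 ((t - a) / w)) :=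
    continuous_const.max (continuous_const.min ((continuous_id.sub continuous_const).div_const _))
  fun_prop

/-- The ramp formula and its derivative. [folklore] -/
theorem hasDerivAt_rampFormula (a w t : ℝ) :
    HasDerivAt (fun s => (1 + cos (π * ((s - a) / w))) / 2)
      (-(π / w) * sin (π * ((t - a) / w)) / 2) t := by
  have h0 : HasDerivAt (fun s : ℝ => (s - a) / w) (1 / w) t := by
    simpa using ((hasDerivAt_id t).sub_const a).div_const w
  have h2 := ((h0.const_mul π).cos.const_add 1).div_const 2
  exact h2.congr_deriv (by ring)

/-- **The derivative of the wall profile** everywhere (the one-sided derivatives vanish at both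
ends of the ramp, so the pieces glue). [folklore] -/
theorem hasDerivAt_wallProfile (hw : 0 < w) (t : ℝ) :
    HasDerivAt (fun s => (1 + cos (π * max 0 (min 1 ((s - a) / w)))) / 2)
      (-(π / w) * sin (π * max 0 (min 1 ((t - a) / w))) / 2) t := by
  have hform : ∀ s ∈ Icc a (a + w),
      (1 + cos (π * max 0 (min 1 ((s - a) / w)))) / 2 = (1 + cos (π * ((s - a) / w))) / 2 := by
    intro s hs; rw [ramp_of_mem hw hs]
  have haw : a < a + w := by linarith
  rcases lt_trichotomy t a with hlt | rfl | hgt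
  · -- left of the ramp: locally constant
    rw [wallProfileDeriv_of_le hw hlt.le]
    refine (hasDerivAt_const t (1 : ℝ)).congr_of_eventuallyEq ?_
    filter_upwards [Iio_mem_nhds hlt] with s hs using wallProfile_of_le hw (le_of_lt hs)
  · -- at the left end of the ramp: glue
    rw [wallProfileDeriv_of_le hw le_rfl]
    have hl : HasDerivWithinAt (fun s => (1 + cos (π * max 0 (min 1 ((s - t) / w)))) / 2) 0
        (Iic t) t :=
      (hasDerivWithinAt_const t (Iic t) (1 : ℝ)).congr_of_mem
        (fun s hs => wallProfile_of_le hw hs) (Set.mem_Iic.2 le_rfl)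
    have hr : HasDerivWithinAt (fun s => (1 + cos (π * max 0 (min 1 ((s - t) / w)))) / 2) 0
        (Ici t) t := by
      have hE : HasDerivWithinAt (fun s => (1 + cos (π * ((s - t) / w))) / 2) 0 (Ici t) t := by
        have := (hasDerivAt_rampFormula t w t).hasDerivWithinAt (s := Ici t)
        simpa using this
      refine hE.congr_of_eventuallyEq ?_ (hform t ⟨le_rfl, haw.le⟩)
      filter_upwards [inter_mem_nhdsWithin (Ici t) (Iio_mem_nhds haw)] with s hs
      exact hform s ⟨hs.1, le_of_lt hs.2⟩
    exact (hl.union hr).hasDerivAt (by rw [Iic_union_Ici]; exact univ_mem)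
  · rcases lt_trichotomy t (a + w) with hlt' | rfl | hgt'
    · -- inside the ramp
      rw [ramp_of_mem hw ⟨hgt.le, hlt'.le⟩]
      refine (hasDerivAt_rampFormula a w t).congr_of_eventuallyEq ?_
      filter_upwards [Ioo_mem_nhds hgt hlt'] with s hs using hform s ⟨hs.1.le, hs.2.le⟩
    · -- at the right end of the ramp: glue
      rw [wallProfileDeriv_of_ge hw le_rfl]
      have hl : HasDerivWithinAt (fun s => (1 + cos (π * max 0 (min 1 ((s - a) / w)))) / 2) 0
          (Iic (a + w)) (a + w) := by
        have hE : HasDerivWithinAt (fun s => (1 + cos (π * ((s - a) / w))) / 2) 0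
            (Iic (a + w)) (a + w) := by
          have := (hasDerivAt_rampFormula a w (a + w)).hasDerivWithinAt (s := Iic (a + w))
          have h1 : (a + w - a) / w = 1 := by rw [add_sub_cancel_left]; exact div_self hw.ne'
          rw [h1, mul_one, sin_pi] at this
          simpa using this
        refine hE.congr_of_eventuallyEq ?_ (hform (a + w) ⟨haw.le, le_rfl⟩)
        filter_upwards [inter_mem_nhdsWithin (Iic (a + w)) (Ioi_mem_nhds haw)] with s hs
        exact hform s ⟨le_of_lt hs.2, hs.1⟩
      have hr : HasDerivWithinAt (fun s => (1 + cos (π * max 0 (min 1 ((s - a) / w)))) / 2) 0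
          (Ici (a + w)) (a + w) :=
        (hasDerivWithinAt_const (a + w) (Ici (a + w)) (0 : ℝ)).congr_of_mem
          (fun s hs => wallProfile_of_ge hw hs) (Set.mem_Ici.2 le_rfl)
      exact (hl.union hr).hasDerivAt (by rw [Iic_union_Ici]; exact univ_mem)
    · -- right of the ramp: locally constant
      rw [wallProfileDeriv_of_ge hw hgt'.le]
      refine (hasDerivAt_const t (0 : ℝ)).congr_of_eventuallyEq ?_
      filter_upwards [Ioi_mem_nhds hgt'] with s hs using wallProfile_of_ge hw (le_of_lt hs)

/-- `deriv` of the wall profile. [folklore] -/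
theorem deriv_wallProfile (hw : 0 < w) (t : ℝ) :
    deriv (fun s => (1 + cos (π * max 0 (min 1 ((s - a) / w)))) / 2) t =
      -(π / w) * sin (π * max 0 (min 1 ((t - a) / w))) / 2 :=
  (hasDerivAt_wallProfile hw t).deriv

/-- **The wall profile is `C¹`.** [folklore] -/
theorem contDiff_wallProfile (hw : 0 < w) :
    ContDiff ℝ 1 (fun s => (1 + cos (π * max 0 (min 1 ((s - a) / w)))) / 2) := by
  refine contDiff_one_iff_deriv.2 ⟨fun t => (hasDerivAt_wallProfile hw t).differentiableAt, ?_⟩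
  have h : deriv (fun s => (1 + cos (π * max 0 (min 1 ((s - a) / w)))) / 2) =
      fun t => -(π / w) * sin (π * max 0 (min 1 ((t - a) / w))) / 2 :=
    funext fun t => (hasDerivAt_wallProfile hw t).deriv
  rw [h]
  exact continuous_wallProfileDeriv a w

/-- **The wall profile, packaged.** For `0 < w` and a wall at `L` there is a `C¹` function
`θ : ℝ → [0, 1]` with `θ = 1` on `(-∞, L - 2w]`, `θ = 0` on `[L - w, ∞)`, `|θ'| ≤ π/(2w)` and
`θ' = 0` off `(L - 2w, ∞)` (namely `t ↦ (1 + cos(π · max 0 (min 1 ((t - (L - 2w))/w))))/2`).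
[folklore] -/
theorem exists_wallProfile {L w : ℝ} (hw : 0 < w) :
    ∃ θ : ℝ → ℝ, ContDiff ℝ 1 θ ∧ (∀ t, 0 ≤ θ t ∧ θ t ≤ 1) ∧
      (∀ t, |deriv θ t| ≤ π / (2 * w)) ∧ (∀ t, deriv θ t ≠ 0 → t ∈ Ioi (L - 2 * w)) ∧
      (∀ t, t ≤ L - 2 * w → θ t = 1) ∧ (∀ t, L - w ≤ t → θ t = 0) := by
  refine ⟨fun s => (1 + cos (π * max 0 (min 1 ((s - (L - 2 * w)) / w)))) / 2,
    contDiff_wallProfile hw, wallProfile_mem (L - 2 * w) w, fun t => ?_, fun t ht => ?_,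
    fun t ht => wallProfile_of_le hw ht, fun t ht => wallProfile_of_ge hw (by linarith)⟩
  · rw [deriv_wallProfile hw]; exact abs_wallProfileDeriv_le hw _ t
  · by_contra hle
    rw [Set.mem_Ioi, not_lt] at hle
    exact ht (by rw [deriv_wallProfile hw]; exact wallProfileDeriv_of_le hw hle)

end Profile

end WallCutoff

/-! ### Poincaré at the right wall, along coordinate lines -/

section Wall

variable {N : ℕ}

/-- On the coordinate line through `X` along `e_{i,k}`, the `(i,k)` coordinate is the parameter.
[folklore] -/
theorem linePoint_apply_self_self (X : Config N) (i : Fin N) (y : Fin 3 → ℝ) (k : Fin 3) (t : ℝ) :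
    linePoint X i y k t i k = t := by
  rw [linePoint_apply_self]
  simp

/-- **Poincaré at the wall, on a line.** For a `C¹` function vanishing as soon as `x_{i,k} ≥ L`,
on every line parallel to `e_{i,k}` the mass beyond `L - s` is at most `s²` times the
`e_{i,k}`-derivative energy beyond `L - s` (one-dimensional Poincaré with the zero at `t = L`).
[folklore] -/
theorem lintegral_line_wall_le {L s : ℝ} (hs : 0 < s) {ψ : Config N → ℂ} (hψ : ContDiff ℝ 1 ψ)
    {i : Fin N} {k : Fin 3} (hzero : ∀ X : Config N, L ≤ X i k → ψ X = 0) (X : Config N)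
    (y : Fin 3 → ℝ) :
    ∫⁻ t, {X : Config N | L - s < X i k}.indicator (fun X => (‖ψ X‖₊ : ℝ≥0∞) ^ 2)
        (linePoint X i y k t) ≤
      ENNReal.ofReal (s ^ 2) * ∫⁻ t, {X : Config N | L - s < X i k}.indicator
        (fun X => (‖fderiv ℝ ψ X (unitVec i k)‖₊ : ℝ≥0∞) ^ 2) (linePoint X i y k t) := by
  set γ : ℝ → Config N := linePoint X i y k with hγ
  set φ : ℝ → ℂ := fun t => ψ (γ t) with hφ
  set φ' : ℝ → ℂ := fun t => fderiv ℝ ψ (γ t) (unitVec i k) with hφ'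
  have hγeq : γ = fun t => linePoint X i y k 0 + t • unitVec i k :=
    funext fun t => linePoint_eq_add_smul X i y k t
  have hγcont : Continuous γ := by rw [hγeq]; fun_prop
  have hderiv : ∀ t, HasDerivAt φ (φ' t) t := by
    intro t
    have hline : HasDerivAt (fun r : ℝ => linePoint X i y k 0 + r • unitVec i k)
        (unitVec i k) t := by
      simpa using ((hasDerivAt_id t).smul_const (unitVec i k)).const_add (linePoint X i y k 0)
    have hψd : HasFDerivAt ψ (fderiv ℝ ψ (γ t)) (linePoint X i y k 0 + t • unitVec i k) := by
      rw [← linePoint_eq_add_smul]; exact (hψ.differentiable one_ne_zero _).hasFDerivAt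
    have hcomp := hψd.comp_hasDerivAt t hline
    have hfun : (ψ ∘ fun r : ℝ => linePoint X i y k 0 + r • unitVec i k) = φ := by
      funext r; simp [φ, γ, ← linePoint_eq_add_smul]
    rwa [hfun] at hcomp
  have hcont' : Continuous φ' :=
    ((hψ.continuous_fderiv one_ne_zero).comp hγcont).clm_apply continuous_const
  have hcoord : ∀ t, γ t i k = t := fun t => linePoint_apply_self_self X i y k t
  have hzero' : ∀ t, L ≤ t → φ t = 0 := fun t ht => hzero _ (by rw [hcoord]; exact ht)
  have hmem : ∀ t, γ t ∈ {X : Config N | L - s < X i k} ↔ L - s < t := by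
    intro t; rw [Set.mem_setOf_eq, hcoord]
  calc ∫⁻ t, {X : Config N | L - s < X i k}.indicator (fun X => (‖ψ X‖₊ : ℝ≥0∞) ^ 2) (γ t)
      ≤ ∫⁻ t, (Ioo (L - s) L).indicator (fun t => (‖φ t‖₊ : ℝ≥0∞) ^ 2) t := by
        refine lintegral_mono fun t => ?_
        by_cases ht : t ∈ Ioo (L - s) L
        · rw [indicator_of_mem ht, indicator_of_mem ((hmem t).2 ht.1)]
        · rw [indicator_of_notMem ht]
          rw [Set.mem_Ioo, not_and_or, not_lt, not_lt] at ht
          rcases ht with ht | ht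
          · rw [indicator_of_notMem (fun h => absurd ((hmem t).1 h) (not_lt.2 ht))]
          · refine (Set.indicator_le_self _ _ _).trans (le_of_eq ?_)
            change (‖φ t‖₊ : ℝ≥0∞) ^ 2 = 0
            rw [hzero' t ht]; simp
    _ = ∫⁻ t in Ioo (L - s) L, (‖φ t‖₊ : ℝ≥0∞) ^ 2 := lintegral_indicator measurableSet_Ioo _
    _ ≤ ENNReal.ofReal ((L - (L - s)) ^ 2) * ∫⁻ t in Ioo (L - s) L, (‖φ' t‖₊ : ℝ≥0∞) ^ 2 :=
        poincare_Ioo_of_zero (tz := L) ⟨by linarith, le_rfl⟩ (hzero' L le_rfl) hderiv hcont'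
    _ ≤ ENNReal.ofReal (s ^ 2) * ∫⁻ t, {X : Config N | L - s < X i k}.indicator
          (fun X => (‖fderiv ℝ ψ X (unitVec i k)‖₊ : ℝ≥0∞) ^ 2) (γ t) := by
        rw [show L - (L - s) = s by ring]
        refine mul_le_mul' le_rfl ?_
        rw [← lintegral_indicator measurableSet_Ioo]
        refine lintegral_mono fun t => ?_
        by_cases ht : t ∈ Ioo (L - s) L
        · rw [indicator_of_mem ht, indicator_of_mem ((hmem t).2 ht.1)]
        · rw [indicator_of_notMem ht]; exact zero_le

/-- The near-wall region `{x_{i,k} > c}` is measurable. [folklore] -/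
theorem measurableSet_coordWall (c : ℝ) (i : Fin N) (k : Fin 3) :
    MeasurableSet {X : Config N | c < X i k} :=
  measurableSet_lt measurable_const (by fun_prop)

/-- **Poincaré at the wall.** For a `C¹` function vanishing as soon as `x_{i,k} ≥ L`, the mass in
`{x_{i,k} > L - s}` is at most `s²` times the `e_{i,k}`-derivative energy there (Fubini over the
lines parallel to `e_{i,k}`). [folklore] -/
theorem lintegral_wall_le {L s : ℝ} (hs : 0 < s) {ψ : Config N → ℂ} (hψ : ContDiff ℝ 1 ψ)
    {i : Fin N} {k : Fin 3} (hzero : ∀ X : Config N, L ≤ X i k → ψ X = 0) :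
    ∫⁻ X in {X : Config N | L - s < X i k}, (‖ψ X‖₊ : ℝ≥0∞) ^ 2 ≤
      ENNReal.ofReal (s ^ 2) *
        ∫⁻ X in {X : Config N | L - s < X i k}, (‖fderiv ℝ ψ X (unitVec i k)‖₊ : ℝ≥0∞) ^ 2 := by
  have hS := measurableSet_coordWall (N := N) (L - s) i k
  rw [← lintegral_indicator hS, ← lintegral_indicator hS]
  have hF : Measurable fun X => {X : Config N | L - s < X i k}.indicator
      (fun X => (‖ψ X‖₊ : ℝ≥0∞) ^ 2) X :=
    (measurable_ennnormSq hψ.continuous).indicator hS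
  have hG : Measurable fun X => {X : Config N | L - s < X i k}.indicator
      (fun X => (‖fderiv ℝ ψ X (unitVec i k)‖₊ : ℝ≥0∞) ^ 2) X :=
    (measurable_ennnormSq_fderiv_apply hψ _).indicator hS
  rw [← lintegral_const_mul _ hG]
  refine lintegral_le_of_forall_line i k hF (measurable_const.mul hG) fun X y => ?_
  rw [lintegral_const_mul _ (show Measurable (fun t => {X : Config N | L - s < X i k}.indicator
      (fun X => (‖fderiv ℝ ψ X (unitVec i k)‖₊ : ℝ≥0∞) ^ 2) (linePoint X i y k t)) from
    hG.comp (continuous_linePoint X i y k).measurable)]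
  exact lintegral_line_wall_le hs hψ hzero X y

end Wall

namespace WallCutoff

/-! ### The product cut-off: pointwise bounds -/

section Cutoff

variable {N : ℕ} {θ : ℝ → ℝ}

/-- Products of numbers in `[0, 1]` lie in `[0, 1]`. [folklore] -/
theorem prod_mem_unit {ι : Type*} (s : Finset ι) (f : ι → ℝ) (h : ∀ i, 0 ≤ f i ∧ f i ≤ 1) :
    0 ≤ ∏ i ∈ s, f i ∧ ∏ i ∈ s, f i ≤ 1 :=
  ⟨Finset.prod_nonneg fun i _ => (h i).1,
    Finset.prod_le_one (fun i _ => (h i).1) fun i _ => (h i).2⟩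

/-- **Kinetic density of the cut-off product, per direction.** With `0 ≤ θ ≤ 1`, `|θ'| ≤ D` and
`θ' = 0` on `(-∞, c]`:
`|∂_{i,k}(ψ χ)|² ≤ |∂_{i,k}ψ|² + 1_{x_{i,k} > c} |∂_{i,k}ψ|² + 2D² 1_{x_{i,k} > c} |ψ|²`
(from `ennnorm_fderiv_cutoffState_sq_le`: the cross term lives where `θ'(x_{i,k}) ≠ 0`).
[folklore] -/
theorem ennnormSq_fderiv_cut_le (hθ : ContDiff ℝ 1 θ) (h01 : ∀ t, 0 ≤ θ t ∧ θ t ≤ 1) {D : ℝ}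
    (hD : ∀ t, |deriv θ t| ≤ D) {c : ℝ} (hc : ∀ t, deriv θ t ≠ 0 → t ∈ Ioi c)
    {ψ : Config N → ℂ} (hψ : ContDiff ℝ 1 ψ) (X : Config N) (i : Fin N) (k : Fin 3) :
    ((‖fderiv ℝ (fun X : Config N => ψ X * ((∏ p : Fin N × Fin 3, θ (X p.1 p.2) : ℝ) : ℂ)) X
        (Pi.single i (EuclideanSpace.single k (1 : ℝ)))‖₊ : ℝ≥0∞)) ^ 2 ≤
      ((‖fderiv ℝ ψ X (Pi.single i (EuclideanSpace.single k (1 : ℝ)))‖₊ : ℝ≥0∞)) ^ 2 +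
        {X : Config N | c < X i k}.indicator
          (fun X => ((‖fderiv ℝ ψ X (Pi.single i (EuclideanSpace.single k (1 : ℝ)))‖₊ :
            ℝ≥0∞)) ^ 2) X +
        2 * ENNReal.ofReal (D ^ 2) *
          {X : Config N | c < X i k}.indicator (fun X => ((‖ψ X‖₊ : ℝ≥0∞)) ^ 2) X := by
  have h := ennnorm_fderiv_cutoffState_sq_le hθ hψ h01 hD hc 0 X i k
  simp only [add_zero] at h
  refine h.trans ?_
  have hQ := prod_mem_unit (Finset.univ : Finset (Fin N × Fin 3)) (fun p => θ (X p.1 p.2))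
    fun p => h01 _
  have hP := prod_mem_unit (Finset.univ.erase (i, k)) (fun p : Fin N × Fin 3 => θ (X p.1 p.2))
    fun p => h01 _
  have hQ1 : ENNReal.ofReal ((∏ p : Fin N × Fin 3, θ (X p.1 p.2)) ^ 2) ≤ 1 :=
    ENNReal.ofReal_le_one.2 (pow_le_one₀ hQ.1 hQ.2)
  have hP1 : ENNReal.ofReal ((∏ p ∈ Finset.univ.erase (i, k), θ (X p.1 p.2)) ^ 2) ≤ 1 :=
    ENNReal.ofReal_le_one.2 (pow_le_one₀ hP.1 hP.2)
  set g : ℝ≥0∞ :=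
    ((‖fderiv ℝ ψ X (Pi.single i (EuclideanSpace.single k (1 : ℝ)))‖₊ : ℝ≥0∞)) ^ 2 with hg
  set m : ℝ≥0∞ := ((‖ψ X‖₊ : ℝ≥0∞)) ^ 2 with hm
  by_cases hX : c < X i k
  · have h1 : (Ioi c).indicator (1 : ℝ → ℝ≥0∞) (X i k) = 1 := by
      rw [indicator_of_mem (show X i k ∈ Ioi c from hX), Pi.one_apply]
    have h2 : ∀ f : Config N → ℝ≥0∞, {X : Config N | c < X i k}.indicator f X = f X :=
      fun f => indicator_of_mem (show X ∈ {X : Config N | c < X i k} from hX) f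
    rw [h1, h2, h2]
    calc ENNReal.ofReal ((∏ p : Fin N × Fin 3, θ (X p.1 p.2)) ^ 2) * g * (1 + 1) +
          2 * ENNReal.ofReal (D ^ 2) * 1 *
            ENNReal.ofReal ((∏ p ∈ Finset.univ.erase (i, k), θ (X p.1 p.2)) ^ 2) * m
        ≤ 1 * g * (1 + 1) + 2 * ENNReal.ofReal (D ^ 2) * 1 * 1 * m := by gcongr
      _ = g + g + 2 * ENNReal.ofReal (D ^ 2) * m := by ring
  · have h1 : (Ioi c).indicator (1 : ℝ → ℝ≥0∞) (X i k) = 0 :=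
      indicator_of_notMem (show X i k ∉ Ioi c from hX) _
    have h2 : ∀ f : Config N → ℝ≥0∞, {X : Config N | c < X i k}.indicator f X = 0 :=
      fun f => indicator_of_notMem (show X ∉ {X : Config N | c < X i k} from hX) f
    rw [h1, h2, h2]
    calc ENNReal.ofReal ((∏ p : Fin N × Fin 3, θ (X p.1 p.2)) ^ 2) * g * (1 + 0) +
          2 * ENNReal.ofReal (D ^ 2) * 0 *
            ENNReal.ofReal ((∏ p ∈ Finset.univ.erase (i, k), θ (X p.1 p.2)) ^ 2) * m
        ≤ 1 * g * (1 + 0) + 2 * ENNReal.ofReal (D ^ 2) * 0 *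
            ENNReal.ofReal ((∏ p ∈ Finset.univ.erase (i, k), θ (X p.1 p.2)) ^ 2) * m := by
          gcongr
      _ = g + 0 + 2 * ENNReal.ofReal (D ^ 2) * 0 := by ring

/-- **Kinetic density of the cut-off product**:
`|∇(ψχ)|² ≤ |∇ψ|² + ∑_{i,k} 1_{x_{i,k} > c} |∂_{i,k}ψ|² + 2D² ∑_{i,k} 1_{x_{i,k} > c} |ψ|²`.
[folklore] -/
theorem kineticDensity_cut_le (hθ : ContDiff ℝ 1 θ) (h01 : ∀ t, 0 ≤ θ t ∧ θ t ≤ 1) {D : ℝ}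
    (hD : ∀ t, |deriv θ t| ≤ D) {c : ℝ} (hc : ∀ t, deriv θ t ≠ 0 → t ∈ Ioi c)
    {ψ : Config N → ℂ} (hψ : ContDiff ℝ 1 ψ) (X : Config N) :
    kineticDensity (fun X : Config N => ψ X * ((∏ p : Fin N × Fin 3, θ (X p.1 p.2) : ℝ) : ℂ)) X ≤
      kineticDensity ψ X +
        ∑ i : Fin N, ∑ k : Fin 3, {X : Config N | c < X i k}.indicator
          (fun X => ((‖fderiv ℝ ψ X (Pi.single i (EuclideanSpace.single k (1 : ℝ)))‖₊ :
            ℝ≥0∞)) ^ 2) X +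
        2 * ENNReal.ofReal (D ^ 2) * ∑ i : Fin N, ∑ k : Fin 3,
          {X : Config N | c < X i k}.indicator (fun X => ((‖ψ X‖₊ : ℝ≥0∞)) ^ 2) X := by
  unfold kineticDensity
  rw [Finset.mul_sum, ← Finset.sum_add_distrib, ← Finset.sum_add_distrib]
  refine Finset.sum_le_sum fun i _ => ?_
  rw [Finset.mul_sum, ← Finset.sum_add_distrib, ← Finset.sum_add_distrib]
  refine Finset.sum_le_sum fun k _ => ?_
  exact ennnormSq_fderiv_cut_le hθ h01 hD hc hψ X i k

/-- **The cut-off product has smaller modulus**: `|ψ χ|² ≤ |ψ|²` (`0 ≤ χ ≤ 1`). [folklore] -/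
theorem ennnormSq_cut_le (h01 : ∀ t, 0 ≤ θ t ∧ θ t ≤ 1) (ψ : Config N → ℂ) (X : Config N) :
    ((‖ψ X * ((∏ p : Fin N × Fin 3, θ (X p.1 p.2) : ℝ) : ℂ)‖₊ : ℝ≥0∞)) ^ 2 ≤
      ((‖ψ X‖₊ : ℝ≥0∞)) ^ 2 := by
  have hQ := prod_mem_unit (Finset.univ : Finset (Fin N × Fin 3)) (fun p => θ (X p.1 p.2))
    fun p => h01 _
  rw [mul_comm, ennorm_real_mul_sq _ hQ.1]
  calc _ ≤ 1 * ((‖ψ X‖₊ : ℝ≥0∞)) ^ 2 := by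
        gcongr
        exact ENNReal.ofReal_le_one.2 (pow_le_one₀ hQ.1 hQ.2)
    _ = _ := one_mul _

/-- **Mass of the cut-off product**: if `θ = 1` on `(-∞, c]` then
`|ψ|² ≤ |ψ χ|² + ∑_{i,k} 1_{x_{i,k} > c} |ψ|²` (`χ = 1` unless some coordinate exceeds `c`).
[folklore] -/
theorem ennnormSq_le_cut_add {c : ℝ} (h1 : ∀ t, t ≤ c → θ t = 1) (ψ : Config N → ℂ)
    (X : Config N) :
    ((‖ψ X‖₊ : ℝ≥0∞)) ^ 2 ≤
      ((‖ψ X * ((∏ p : Fin N × Fin 3, θ (X p.1 p.2) : ℝ) : ℂ)‖₊ : ℝ≥0∞)) ^ 2 +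
        ∑ i : Fin N, ∑ k : Fin 3,
          {X : Config N | c < X i k}.indicator (fun X => ((‖ψ X‖₊ : ℝ≥0∞)) ^ 2) X := by
  by_cases h : ∃ i k, c < X i k
  · obtain ⟨i, k, hik⟩ := h
    refine le_add_left ?_
    calc ((‖ψ X‖₊ : ℝ≥0∞)) ^ 2
        = {X : Config N | c < X i k}.indicator (fun X => ((‖ψ X‖₊ : ℝ≥0∞)) ^ 2) X :=
          (indicator_of_mem (show X ∈ {X : Config N | c < X i k} from hik)
            (fun X => ((‖ψ X‖₊ : ℝ≥0∞)) ^ 2)).symm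
      _ ≤ ∑ k' : Fin 3,
            {X : Config N | c < X i k'}.indicator (fun X => ((‖ψ X‖₊ : ℝ≥0∞)) ^ 2) X :=
          Finset.single_le_sum (f := fun k' => {X : Config N | c < X i k'}.indicator
            (fun X => ((‖ψ X‖₊ : ℝ≥0∞)) ^ 2) X) (fun _ _ => zero_le) (Finset.mem_univ k)
      _ ≤ _ :=
          Finset.single_le_sum (f := fun i' => ∑ k' : Fin 3,
            {X : Config N | c < X i' k'}.indicator (fun X => ((‖ψ X‖₊ : ℝ≥0∞)) ^ 2) X)
            (fun _ _ => zero_le) (Finset.mem_univ i)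
  · push Not at h
    have hQ : ∏ p : Fin N × Fin 3, θ (X p.1 p.2) = 1 :=
      Finset.prod_eq_one fun p _ => h1 _ (h p.1 p.2)
    rw [hQ, Complex.ofReal_one, mul_one]
    exact le_self_add

/-- Integrating a double sum of indicators:
`∫ ∑_{i,k} 1_{S_{ik}} F_{ik} = ∑_{i,k} ∫_{S_{ik}} F_{ik}`. [folklore] -/
theorem lintegral_sum_sum_indicator {F : Fin N → Fin 3 → Config N → ℝ≥0∞}
    (hF : ∀ i k, Measurable (F i k)) {S : Fin N → Fin 3 → Set (Config N)}
    (hS : ∀ i k, MeasurableSet (S i k)) :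
    ∫⁻ X, ∑ i : Fin N, ∑ k : Fin 3, (S i k).indicator (F i k) X =
      ∑ i : Fin N, ∑ k : Fin 3, ∫⁻ X in S i k, F i k X := by
  rw [lintegral_finsetSum _ fun i _ =>
    show Measurable (fun X => ∑ k : Fin 3, (S i k).indicator (F i k) X) from
      Finset.measurable_sum _ fun k _ => (hF i k).indicator (hS i k)]
  refine Finset.sum_congr rfl fun i _ => ?_
  rw [lintegral_finsetSum _ fun k _ => (hF i k).indicator (hS i k)]
  exact Finset.sum_congr rfl fun k _ => lintegral_indicator (hS i k) _

end Cutoff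

end WallCutoff

end Literature.MathematicalPhysics.QuantumManyBody.BoseGas

end
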